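import Summits.Schanuel.Schanuel.Theorems.DiophantineDichotomyApproximationPropertyDefs
import Mathlib.Algebra.Algebra.Hom.Rat
import Mathlib.FieldTheory.Normal.Closure
import Mathlib.FieldTheory.PrimitiveElement
import Mathlib.NumberTheory.NumberField.Basic
import Mathlib.RingTheory.Ideal.Norm.RelNorm
import HarnessLib

/-!
# The deficient lever, number-field kit: Galois hull, fibres of restriction, norm of an extended ideal (stmt-Schanuel-6117)

Crux `stmt-Schanuel-6117` (`Summit.Schanuel.Schanuel.Theses.DiophantineDichotomy.ApproximationProperty`),
route `DiophantineDichotomy`, line `orbit-interpolation-determinant`, lead c8, registered sub-goal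
`embedding_kit` (`--supports stmt-Schanuel-6117`; wave R1, the deficient-rank Galois-orbit
interpolation determinant, consumed by `orbitClusterBoundDeficient_of`).

Pure algebraic number theory, all PROVED from Mathlib (no definitions, no named facts). The
deficient-rank lever takes the norm of an `r × r` minor from a hull `L` of the number field `K`
down to `ℚ`; it needs exactly the three facts packaged here:

* `EmbeddingKit.hull` — (i) for a number field `K` there is a number field `L` with ONE complex
  embedding `ι : L → ℂ` through which EVERY complex embedding `σ` of `K` factors
  (`σ = ι ∘ lift σ`): `L` is Mathlib's `normalClosure ℚ K ℂ` (the compositum of the conjugate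
  fields `σ(K) ⊂ ℂ`, finite-dimensional over `ℚ`), `ι` its inclusion in `ℂ`, `lift σ` the
  corestriction of `σ` (`AlgHom.fieldRange_le_normalClosure`).
* `EmbeddingKit.fibre` — (ii) along any embedding `φ : K → L` of number fields, `[K:ℚ] ∣ [L:ℚ]`
  and every complex embedding `ρ` of `K` has exactly `[L:ℚ]/[K:ℚ] = [L:K]` extensions
  `τ : L → ℂ` with `τ ∘ φ = ρ` (`AlgHom.card`: a finite separable extension of degree `n` has `n`
  embeddings over `K` into an algebraically closed field; `Module.finrank_mul_finrank`).
* `EmbeddingKit.absNorm_map` — (iii) `N(𝔞𝓞_L) = N(𝔞)^{[L:K]}` for an ideal `𝔞` of `𝓞_K` extended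
  along `φ` (`Ideal.absNorm_algebraMap`, transitivity of the ideal norm, with the degree of the
  fraction fields rewritten as `[L:K]` along `FractionRing.algEquiv`).
* `embedding_kit` (registered sub-goal, verbatim) — the conjunction (i) ∧ (ii) ∧ (iii).

Sources: folklore / Mathlib (`Mathlib.FieldTheory.Normal.Closure`, `Mathlib.FieldTheory.PrimitiveElement`,
`Mathlib.RingTheory.Ideal.Norm.RelNorm`); the same two computations appear in the tree as
`NumberField.card_filter_comp_algebraMap_eq` (Literature/NumberTheory/EllipticCurves/HeightsBaseChangeProofs.lean)
and `Literature.NumberTheory.DiophantineGeometry.absNorm_map_algebraMap_ringOfIntegers`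
(StableFaltingsHeightMapProofs.lean), stated there for an `[Algebra K L]` instance; here they are
re-derived for a bare ring homomorphism `φ` to keep this file's imports inside Mathlib.
-/

noncomputable section

-- `Summit.Schanuel.Schanuel.…` is the mandated summit/sub-problem namespace (single-conjunct summit), hence:
set_option linter.dupNamespace false

namespace Summit.Schanuel.Schanuel.Cruxes.ApproximationProperty.OrbitInterpolationDeterminant

open NumberField Module IntermediateField

namespace EmbeddingKit

/-- **(i) A hull with a universal embedding.** For a number field `K` there is a number field `L`,
an embedding `ι : L →+* ℂ` and, for every complex embedding `σ` of `K`, an embedding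
`lift σ : K →+* L` with `ι ∘ lift σ = σ`: take `L = normalClosure ℚ K ℂ ⊂ ℂ`, the compositum of
the conjugate fields of `K` in `ℂ`. [folklore] -/
theorem hull (K : Type) [Field K] [NumberField K] :
    ∃ (L : Type) (_ : Field L) (_ : NumberField L) (ι : L →+* ℂ) (lift : (K →+* ℂ) → (K →+* L)),
      ∀ σ : K →+* ℂ, ι.comp (lift σ) = σ := by
  haveI : NumberField (normalClosure ℚ K ℂ) :=
    NumberField.of_module_finite ℚ (normalClosure ℚ K ℂ)
  have hmem : ∀ (σ : K →+* ℂ) (x : K), σ x ∈ normalClosure ℚ K ℂ := fun σ x =>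
    σ.toRatAlgHom.fieldRange_le_normalClosure ⟨x, rfl⟩
  exact ⟨normalClosure ℚ K ℂ, inferInstance, inferInstance, (normalClosure ℚ K ℂ).toSubfield.subtype,
    fun σ => σ.codRestrict (normalClosure ℚ K ℂ) (hmem σ), fun σ => RingHom.ext fun _ => rfl⟩

/-- Along an embedding `φ : K → L` of number fields (made the `K`-algebra structure of `L`),
`[L:ℚ] / [K:ℚ] = [L:K]` (tower law `[K:ℚ]·[L:K] = [L:ℚ]`, `[K:ℚ] > 0`). [folklore] -/
theorem finrank_div_finrank (K L : Type) [Field K] [NumberField K] [Field L] [NumberField L]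
    [Algebra K L] : finrank ℚ L / finrank ℚ K = finrank K L := by
  rw [← finrank_mul_finrank ℚ K L, Nat.mul_div_cancel_left _ finrank_pos]

/-- **(ii) Fibres of restriction of embeddings.** Along an embedding `φ : K → L` of number fields,
`[K:ℚ] ∣ [L:ℚ]` and a complex embedding `ρ` of `K` has exactly `[L:ℚ]/[K:ℚ]` extensions
`τ : L →+* ℂ` with `τ ∘ φ = ρ` (these are the `K`-algebra homomorphisms `L →ₐ[K] ℂ` for the
`K`-algebra structures `φ` on `L` and `ρ` on `ℂ`; `AlgHom.card`). [folklore] -/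
theorem fibre (K L : Type) [Field K] [NumberField K] [Field L] [NumberField L] (φ : K →+* L)
    (ρ : K →+* ℂ) :
    finrank ℚ K ∣ finrank ℚ L ∧
      Nat.card {τ : L →+* ℂ // τ.comp φ = ρ} = finrank ℚ L / finrank ℚ K := by
  letI : Algebra K L := φ.toAlgebra
  letI : Algebra K ℂ := ρ.toAlgebra
  refine ⟨⟨finrank K L, (finrank_mul_finrank ℚ K L).symm⟩, ?_⟩
  rw [finrank_div_finrank K L]
  -- adapted from Literature/NumberTheory/EllipticCurves/HeightsBaseChangeProofs.lean
  -- (`NumberField.card_filter_comp_algebraMap_eq`)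
  let e : {τ : L →+* ℂ // τ.comp φ = ρ} ≃ (L →ₐ[K] ℂ) :=
    { toFun := fun τ => { (τ.1 : L →+* ℂ) with commutes' := fun k => RingHom.congr_fun τ.2 k }
      invFun := fun g => ⟨g.toRingHom, RingHom.ext fun k => g.commutes k⟩
      left_inv := fun τ => by ext; rfl
      right_inv := fun g => by ext; rfl }
  rw [Nat.card_congr e, Nat.card_eq_fintype_card, AlgHom.card K L ℂ]

/-- **(iii) Norm of an extended ideal.** Along an embedding `φ : K → L` of number fields, for an
ideal `𝔞` of `𝓞 K`: `N(𝔞 𝓞_L) = N(𝔞)^{[L:ℚ]/[K:ℚ]}`, where `𝔞 𝓞_L` is the extension of `𝔞` along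
the restriction `𝓞 K →+* 𝓞 L` of `φ` (Mathlib's `Ideal.absNorm_algebraMap`, transitivity of the
ideal norm, with `[Frac 𝓞_L : Frac 𝓞_K] = [L:K] = [L:ℚ]/[K:ℚ]`). [folklore] -/
theorem absNorm_map (K L : Type) [Field K] [NumberField K] [Field L] [NumberField L]
    (φ : K →+* L) (𝔞 : Ideal (𝓞 K)) :
    Ideal.absNorm (𝔞.map (RingOfIntegers.mapRingHom φ)) =
      Ideal.absNorm 𝔞 ^ (finrank ℚ L / finrank ℚ K) := by
  letI : Algebra K L := φ.toAlgebra
  rw [finrank_div_finrank K L]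
  -- `algebraMap (𝓞 K) (𝓞 L)` IS `mapRingHom (algebraMap K L) = mapRingHom φ` (`inst_ringOfIntegersAlgebra`)
  change Ideal.absNorm (𝔞.map (algebraMap (𝓞 K) (𝓞 L))) = _
  -- adapted from Literature/NumberTheory/DiophantineGeometry/StableFaltingsHeightMapProofs.lean
  -- (`absNorm_map_algebraMap_ringOfIntegers`)
  rw [Ideal.absNorm_algebraMap]
  congr 1
  letI := FractionRing.liftAlgebra (𝓞 K) (FractionRing (𝓞 L))
  exact Algebra.finrank_eq_of_equiv_equiv (FractionRing.algEquiv (𝓞 K) K).toRingEquiv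
    (FractionRing.algEquiv (𝓞 L) L).toRingEquiv (by
      ext z
      exact IsFractionRing.algEquiv_commutes (FractionRing.algEquiv (𝓞 K) K)
        (FractionRing.algEquiv (𝓞 L) L) z)

end EmbeddingKit

/-- **Registered sub-goal `embedding_kit` — the number-field kit of the deficient lever.**
(i) every number field `K` has a number field `L` with an embedding `ι : L → ℂ` through which every
complex embedding of `K` factors; (ii) along any embedding `φ : K → L` of number fields,
`[K:ℚ] ∣ [L:ℚ]` and every complex embedding of `K` has exactly `[L:ℚ]/[K:ℚ]` extensions to `L`;
(iii) the norm of an ideal of `𝓞 K` extended to `𝓞 L` along `φ` is its norm to the power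
`[L:ℚ]/[K:ℚ]`. [folklore] -/
theorem embedding_kit : (∀ (K : Type) [Field K] [NumberField K], ∃ (L : Type) (_ : Field L) (_ : NumberField L) (ι : L →+* ℂ) (lift : (K →+* ℂ) → (K →+* L)), ∀ σ : K →+* ℂ, ι.comp (lift σ) = σ) ∧ (∀ (K L : Type) [Field K] [NumberField K] [Field L] [NumberField L] (φ : K →+* L) (ρ : K →+* ℂ), Module.finrank ℚ K ∣ Module.finrank ℚ L ∧ Nat.card {τ : L →+* ℂ // τ.comp φ = ρ} = Module.finrank ℚ L / Module.finrank ℚ K) ∧ (∀ (K L : Type) [Field K] [NumberField K] [Field L] [NumberField L] (φ : K →+* L) (𝔞 : Ideal (NumberField.RingOfIntegers K)), Ideal.absNorm (𝔞.map (NumberField.RingOfIntegers.mapRingHom φ)) = Ideal.absNorm 𝔞 ^ (Module.finrank ℚ L / Module.finrank ℚ K)) :=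
  ⟨fun K _ _ => EmbeddingKit.hull K, fun K L _ _ _ _ φ ρ => EmbeddingKit.fibre K L φ ρ,
    fun K L _ _ _ _ φ 𝔞 => EmbeddingKit.absNorm_map K L φ 𝔞⟩

end Summit.Schanuel.Schanuel.Cruxes.ApproximationProperty.OrbitInterpolationDeterminant

end
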